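import Mathlib
import Literature.AlgebraicGeometry.Resolution.CobordantGame
import Literature.AlgebraicGeometry.Resolution.CobordantChartCoefficients
import Literature.AlgebraicGeometry.Resolution.CobordantTupleGame

/-!
# `WeightedInvariant.LocalWeightedDrop`, line `tame-four-tuple-drop` (res-L1-w43-strat-1): DEFINITIONS of the radical non-normal-crossing
# count with free smooth centres — `SpaceIsNC`, `SpaceGermNonNCCountRad` (three variables, VERBATIM from the line file) and their
# dimension-generic forms `GermIsNC`, `GermNonNCCountRad`

Crux item stmt-ResolutionOfSingularities-8899 `LocalWeightedDrop` (route `ResolutionOfSingularities/WeightedInvariant`); strategist line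
`L/res-L1-w43-strat-1/tame_four_tuple_drop_v1.lean` (sha16 9c94f6e133b67480) for the N = 4 TAME residual `stub_tameWideApexFourStartsWon`
(= v28's T″ at `n := 0`).  [OURS · L1 W4.3, chain w43; defs module landed FIRST by res-type-056 (holder of stub (A3)
`stub_spaceNonNCCountRad_of_CJS`, CHAIN v4.5.1) on the arbiter's ruling res-L1-w43-strat-1 05:36:14Z (2) «land once», so that (G3) (res-type-088,
`tupleDrop_of_count_of_monomialPhase`, p501911 — predicate- and dimension-generic, def-free) and (B3) can import.  The objects are the programme's
own (the coefficient-tuple game of `Literature/…/CobordantTupleGame.lean` one dimension up from the landed plane case `PlaneGerm.IsNC` /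
`PlaneGermNonNCCountRad`); nothing here is a statement of any manuscript.]

* `GermIsNC b` (`b ∈ k⟦x₀,…,x_{n−1}⟧`) — NORMAL-CROSSING SUPPORT: in some formal coordinates `Φ` (constant-free, invertible linear part)
  `b∘Φ = u · ∏ xᵢ^{eᵢ}` with `u(0) ≠ 0`; `SpaceIsNC` = the line file's three-variable spelling (`Iff.rfl`-equal, `spaceIsNC_iff`).
* `GermNonNCCountRad k m` — THE RADICAL NON-NC COUNT WITH FREE SMOOTH CENTRES on germs in `m + 1` variables: `∃ ν : k⟦x⟧ → ℕ` with
  (i) `ν b = 0 ↔ GermIsNC b` (`b ≠ 0`); (ii) radical monotonicity `b ∣ d^(N+1) → ν b ≤ ν d` (`d ≠ 0`); (iii) from every non-zero `b` whose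
  support is not a normal crossing a MOVE — a legal coordinate change `Φ` and weights `w ∈ {0,1}^{m+1} ∖ 0` (a smooth centre through the
  point) — such that at every exceptional point `c ≠ 0` (with `cᵢ = 0` on the weight-`0` slots) and every factorisation
  `b∘Φ(chart_{w,c}) = s^A · G`, `s ∤ G`, some live slot `i` (`cᵢ ≠ 0`) has `ν (s · G|_{y′ᵢ = 0}) < ν b`.  The three clauses are, in order and
  shape, EXACTLY the hypotheses `hν1 hν2 hν3` of `tupleDrop_of_count_of_monomialPhase m GermIsNC ν` (p501911); `SpaceGermNonNCCountRad k` =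
  the line file's spelling at `Fin 3` (`spaceGermNonNCCountRad_iff`).
The (B3) notion `SpaceMonomialPhase` is landed by the (B3) owner (arbiter's ruling).
-/

set_option linter.dupNamespace false -- mandated namespace of this single-conjunct summit

namespace Summit.ResolutionOfSingularities.ResolutionOfSingularities.Theorems

namespace TameFourTupleDrop

open Literature.AlgebraicGeometry.Resolution

variable {k : Type} [Field k]

/-! ## Normal-crossing support -/

/-- NORMAL-CROSSING SUPPORT for a germ in `n` variables: in some formal coordinates `Φ` (constant-free, invertible linear part)
`b∘Φ = u · ∏ᵢ xᵢ^{eᵢ}` with `u(0) ≠ 0` (the tree's `PlaneGerm.IsNC` in any dimension). -/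
def GermIsNC {n : ℕ} (b : MvPowerSeries (Fin n) k) : Prop :=
  ∃ (Φ : Fin n → MvPowerSeries (Fin n) k) (u : MvPowerSeries (Fin n) k) (e : Fin n → ℕ),
    (∀ i, MvPowerSeries.constantCoeff (Φ i) = 0) ∧
    IsUnit (Matrix.det (Matrix.of fun i j => MvPowerSeries.coeff (Finsupp.single j 1) (Φ i))) ∧
    MvPowerSeries.constantCoeff u ≠ 0 ∧
    MvPowerSeries.subst Φ b = u * ∏ i, MvPowerSeries.X i ^ e i

/-- NORMAL-CROSSING SUPPORT for a germ in three variables: in some formal coordinates `Φ` (constant-free, invertible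
linear part) `b∘Φ = u · x₀^n₀ · x₁^n₁ · x₂^n₂` with `u(0) ≠ 0` (the tree's `PlaneGerm.IsNC` one dimension up).  [VERBATIM from the line file
`tame_four_tuple_drop_v1.lean`.] -/
def SpaceIsNC (b : MvPowerSeries (Fin 3) k) : Prop :=
  ∃ (Φ : Fin 3 → MvPowerSeries (Fin 3) k) (u : MvPowerSeries (Fin 3) k) (n : Fin 3 → ℕ),
    (∀ i, MvPowerSeries.constantCoeff (Φ i) = 0) ∧
    IsUnit (Matrix.det (Matrix.of fun i j => MvPowerSeries.coeff (Finsupp.single j 1) (Φ i))) ∧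
    MvPowerSeries.constantCoeff u ≠ 0 ∧
    MvPowerSeries.subst Φ b = u * ∏ i, MvPowerSeries.X i ^ n i

/-- The three-variable spelling is the generic one. -/
theorem spaceIsNC_iff (b : MvPowerSeries (Fin 3) k) : SpaceIsNC b ↔ GermIsNC b := Iff.rfl

/-! ## The radical non-NC count with free smooth centres -/

variable (k) in
/-- THE RADICAL NON-NORMAL-CROSSING COUNT WITH FREE SMOOTH CENTRES for germs in `m + 1` variables: a count `ν : k⟦x⟧ → ℕ` with
(i) `ν b = 0 ↔ GermIsNC b` for `b ≠ 0`; (ii) radical monotonicity `b ∣ d^(N+1) → ν b ≤ ν d` (`d ≠ 0`); (iii) from every non-zero `b` whose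
support is not a normal crossing there is a move — a legal coordinate change `Φ` and weights `w ∈ {0,1}^{m+1} ∖ 0` — such that at
every exceptional point `c ≠ 0` (with `cᵢ = 0` on the weight-`0` slots), for every factorisation `b∘Φ(chart) = s^A · G`, `s ∤ G`, some
slot `i` with `cᵢ ≠ 0` has `ν (s · G|_{y′ᵢ = 0}) < ν b`.  Clauses (i)–(iii) = the hypotheses `hν1`–`hν3` of
`tupleDrop_of_count_of_monomialPhase m GermIsNC ν` (p501911), in order and shape. -/
def GermNonNCCountRad (m : ℕ) : Prop :=
  ∃ ν : MvPowerSeries (Fin (m + 1)) k → ℕ,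
    (∀ b : MvPowerSeries (Fin (m + 1)) k, b ≠ 0 → (ν b = 0 ↔ GermIsNC b)) ∧
    (∀ b d : MvPowerSeries (Fin (m + 1)) k, d ≠ 0 → ∀ N : ℕ, b ∣ d ^ (N + 1) → ν b ≤ ν d) ∧
    (∀ b : MvPowerSeries (Fin (m + 1)) k, b ≠ 0 → ¬ GermIsNC b →
      ∃ (Φ : Fin (m + 1) → MvPowerSeries (Fin (m + 1)) k) (w : Fin (m + 1) → ℕ),
        (∀ i, MvPowerSeries.constantCoeff (Φ i) = 0) ∧
        IsUnit (Matrix.det (Matrix.of fun i j => MvPowerSeries.coeff (Finsupp.single j 1) (Φ i))) ∧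
        (∀ i, w i ≤ 1) ∧ (∃ i, 0 < w i) ∧
        ∀ c : Fin (m + 1) → k, (∀ i, w i = 0 → c i = 0) → c ≠ 0 →
          ∀ (A : ℕ) (G : MvPowerSeries (Fin (m + 1 + 1)) k),
            MvPowerSeries.subst (CobordantChart.chart w c) (MvPowerSeries.subst Φ b) = MvPowerSeries.X 0 ^ A * G →
            ¬ (MvPowerSeries.X (0 : Fin (m + 1 + 1)) ∣ G) →
            ∃ i : Fin (m + 1), c i ≠ 0 ∧ ν (MvPowerSeries.X 0 * TupleGame.slice i G) < ν b)

variable (k) in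
/-- THE RADICAL NON-NORMAL-CROSSING COUNT FOR SURFACE GERMS IN 3-SPACE, free smooth centres (the tree's
`PlaneGermNonNCCountRad` one dimension up, with the point blow-up replaced by a move of the count's choosing): a count
`ν : k⟦x₀,x₁,x₂⟧ → ℕ` with (i) `ν b = 0 ↔ SpaceIsNC b` for `b ≠ 0`; (ii) radical monotonicity `b ∣ d^(N+1) → ν b ≤ ν d`;
(iii) from every non-zero `b` whose support is not a normal crossing there is a move — a legal coordinate change `Φ`
and weights `w ∈ {0,1}³ ∖ 0` (a smooth centre through the point) — such that at every exceptional point `c ≠ 0` (with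
`c_i = 0` on the weight-`0` slots), for the factorisation `b∘Φ(chart) = s^A · G`, `s ∤ G`, some slot `i` with `c_i ≠ 0`
has `ν (s · G|_{y_i' = 0}) < ν b` (one copy of the exceptional divisor times the sliced strict transform: the reduced
total transform read in the standard chart).  [VERBATIM from the line file `tame_four_tuple_drop_v1.lean`.] -/
def SpaceGermNonNCCountRad : Prop :=
  ∃ ν : MvPowerSeries (Fin 3) k → ℕ,
    (∀ b : MvPowerSeries (Fin 3) k, b ≠ 0 → (ν b = 0 ↔ SpaceIsNC b)) ∧
    (∀ b d : MvPowerSeries (Fin 3) k, d ≠ 0 → ∀ N : ℕ, b ∣ d ^ (N + 1) → ν b ≤ ν d) ∧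
    (∀ b : MvPowerSeries (Fin 3) k, b ≠ 0 → ¬ SpaceIsNC b →
      ∃ (Φ : Fin 3 → MvPowerSeries (Fin 3) k) (w : Fin 3 → ℕ),
        (∀ i, MvPowerSeries.constantCoeff (Φ i) = 0) ∧
        IsUnit (Matrix.det (Matrix.of fun i j => MvPowerSeries.coeff (Finsupp.single j 1) (Φ i))) ∧
        (∀ i, w i ≤ 1) ∧ (∃ i, 0 < w i) ∧
        ∀ c : Fin 3 → k, (∀ i, w i = 0 → c i = 0) → c ≠ 0 →
          ∀ (A : ℕ) (G : MvPowerSeries (Fin (3 + 1)) k),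
            MvPowerSeries.subst (CobordantChart.chart w c) (MvPowerSeries.subst Φ b) = MvPowerSeries.X 0 ^ A * G →
            ¬ (MvPowerSeries.X (0 : Fin (3 + 1)) ∣ G) →
            ∃ i : Fin 3, c i ≠ 0 ∧ ν (MvPowerSeries.X 0 * TupleGame.slice i G) < ν b)

/-- The three-variable spelling is the generic one at `m = 2`. -/
theorem spaceGermNonNCCountRad_iff : SpaceGermNonNCCountRad k ↔ GermNonNCCountRad k 2 := Iff.rfl

end TameFourTupleDrop

end Summit.ResolutionOfSingularities.ResolutionOfSingularities.Theorems
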